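import Summits.ResolutionOfSingularities.ResolutionOfSingularities.Theorems.PurelyInseparableDim4Target
import Literature.AlgebraicGeometry.Resolution.CentreBlowupOrdAlongBasics
import Literature.AlgebraicGeometry.Resolution.CoordinateBlowupChart
import HarnessLib

/-!
# Purely inseparable four-folds `z^p + F(x₁, …, x₄)`: the chart dictionary for coordinate centres,
# RING LEVEL (brick TY-2 (a) of cell `res-dim4-pi`: coordinate change · translation · cleaning)

[OURS · counted 0] (D-0157 DOOR 2; director-resolution DR-157-C; desk `boards/WAVE2.md` row TY-2
«chart dictionary for coordinate centres = S3 (a)»). Cell `res-dim4-pi` runs the coordinate-centre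
walk of the tree (`CentreBlowup.chartTransform / pointTransform / step`,
`PointBlowupShadeCentres.lean`) on presented states `(F, r, exc)` of the class
`z^p + F(x₁, …, x₄)`; its frame `PIDim4.TerminationImpliesOrderReduction` (file
`PurelyInseparableDim4Target.lean`, §4) needs the DICTIONARY between that combinatorial step and
the blowing up of `𝔸⁵_K = Spec K[z, x₁, …, x₄]` along the coordinate subspace `V(z, x_S)`.
This file is the RING-LEVEL half (the scheme-level half — the controlled transform of the ideal
sheaf `PIDim4.hypSheaf p F` under ANY blowing up of `𝔸⁵_K` along `V(z, x_S)`, read on the tree's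
chart `AffineCoordBlowup.chartImm` — is `PurelyInseparableDim4ChartTransfer.lean`). Everything is
PROVED; no `sorry`, no new axiom; nothing here is a statement about resolution of singularities in
dimension ≥ 4 / characteristic `p` (which is NOT proved anywhere in this programme).

## What is proved

Write `z = X 0`, `xᵢ = X i.succ` (`PIDim4.hyp p F = z^p + F(x)`), `Λ_S = {z} ∪ {xᵢ : i ∈ S}`
(spelled `insert 0 (Fin.succ '' S) ⊆ Fin 5` throughout; no definition is introduced) for
`S ⊆ {1, …, 4}`, and `ψ = coordBlowupSubst K Λ_S x_j` for the tree's chart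
substitution of the `x_j`-chart of `Bl_{V(Λ_S)} 𝔸⁵` (`CoordinateBlowupChart.lean`, Hu 2025 Prop. 5.3 /
Görtz–Wedhorn (13.19): `z ↦ x_j z`, `xᵢ ↦ x_j xᵢ` (`i ∈ S ∖ j`), the other variables fixed).

* §1 (any index type `σ`, any commutative ring `K`) `coordBlowupSubst_eq_X_pow_mul_chartTransform` —
  **no truncation under permissibility**: for `j ∈ S` and `q ≤ ord_{(x_S)} F`
  (`CentreBlowup.ordAlong`, condition (1) of Hauser–Perlega §2 = `PIDim4.IsPermissibleCentre`),
  `coordBlowupSubst K S j F = x_j^q · CentreBlowup.chartTransform q S j F` — the tree's monomial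
  chart law IS «total transform divided by `x_j^q`» (re-proved here against the tree's
  `coordBlowupSubst`; a private copy for a local substitution exists in `PointBlowupNearRidge.lean`).
* §2 `coordBlowupSubst_hyp` — **the total transform of the hypersurface**:
  `ψ (z^q + F) = x_j^q · (z^q + F')`, `F' = chartTransform q S j F`, for `j ∈ S`, `q ≤ ord_{(x_S)} F`.
* §3 `translate_hyp` — **translation to the point `b` of the chart** (`x ↦ x + b`, `z ↦ z`):
  `translate (0, b) (z^q + G) = z^q + translate b G` (the tree's `PointBlowup.translate`), hence
  `z^q + CentreBlowup.pointTransform q S j b s` from `z^q + F'`.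
* §4 `cleanEquiv h` — **the cleaning coordinate change** `z ↦ z + h(x)` as a `K`-algebra
  automorphism of `K[z, x]`; in characteristic `p`, `cleanEquiv h (z^{p^k} + G) = z^{p^k} + (G + h^{p^k})`
  (`cleanEquiv_hyp`), and over a PERFECT ring of characteristic `p` some `h` realises the tree's
  cleaning `Hauser2010.deletePthPowers` (`exists_cleanEquiv_hyp_eq_deletePthPowers`, from the tree's
  `exists_add_pow_eq_deletePthPowers`).
* §5 **THE RING-LEVEL DICTIONARY** `exists_clean_translate_hyp_chartTransform_eq_step` /
  `exists_clean_translate_coordBlowupSubst_hyp_eq_step`: for a presented state `s`, a permissible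
  `S ∋ j` and a point `b` of the exceptional hyperplane (`b_j = 0`) there is a cleaning polynomial `h`
  with `cleanEquiv h (translate (0,b) (z^p + F')) = z^p + (CentreBlowup.step p S j b s).F` and
  `cleanEquiv h (translate (0,b) (ψ (z^p + s.F))) = x_j^p · (z^p + (CentreBlowup.step p S j b s).F)`:
  the `x_j`-chart of the blow-up along `V(z, x_S)`, re-centred at `b` and cleaned, carries the total
  transform of `z^p + s.F` to `x_j^p` (exceptional factor, multiplicity `p`) times the equation of the
  tree's next state — i.e. the controlled (= strict) transform with `m = p` is `z^p + step.F`.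

Sources of the objects: Hauser–Perlega PRIMS 55 (2019) §2, Hauser BAMS 47 (2010) §§F–G, Hu 2025
Prop. 5.3 / Görtz–Wedhorn (13.19) — all through the tree files cited; nothing is restated. bears_on:
LADDER-RESOLUTION:D157-DOOR2 (res-dim4-pi). Supports stmt-ResolutionOfSingularities-16155 (helper, TY-2 (a)).
-/

-- every declaration of this summit lives under `Summit.ResolutionOfSingularities.ResolutionOfSingularities`
-- (summit = problem), which the duplicate-namespace linter flags; house convention (cf. the Target file).
set_option linter.dupNamespace false

noncomputable section

open MvPolynomial Finset

open scoped BigOperators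

namespace Summit.ResolutionOfSingularities.ResolutionOfSingularities.Theorems.PIDim4

open Literature.AlgebraicGeometry.Resolution
open Literature.AlgebraicGeometry.Resolution.Hauser2010

namespace ChartDictionary

/-! ## §1 Any index type: the chart substitution of `C_S` is `x_j^q` times the chart transform -/

section General

variable {σ : Type*} [DecidableEq σ] {K : Type*} [CommRing K]

/-- The chart substitution on a monomial, as a product: `∏ᵢ ψ(xᵢ^{dᵢ}) = x_j^{Σ_{i ∈ S ∖ j} dᵢ} · x^d`
(`ψ = coordBlowupSubst K S j`: `xᵢ ↦ x_j xᵢ` for `i ∈ S ∖ j`, identity otherwise). -/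
theorem prod_coordBlowupSubst_X_pow (S : Finset σ) (j : σ) (d : σ →₀ ℕ) :
    d.prod (fun i k => coordBlowupSubst K (S : Set σ) j (X i ^ k)) =
      X j ^ (∑ i ∈ S.erase j, d i) * monomial d (1 : K) := by
  have h1 : d.prod (fun i k => coordBlowupSubst K (S : Set σ) j (X i ^ k)) =
      d.prod (fun i k => (X j : MvPolynomial σ K) ^ (if i ∈ S ∧ i ≠ j then k else 0) * X i ^ k) := by
    refine Finsupp.prod_congr fun i _ => ?_
    rw [map_pow, coordBlowupSubst_X]
    by_cases h : i ∈ S ∧ i ≠ j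
    · rw [if_pos (show i ∈ (S : Set σ) ∧ i ≠ j from h), if_pos h, mul_pow]
    · rw [if_neg (show ¬ (i ∈ (S : Set σ) ∧ i ≠ j) from h), if_neg h, pow_zero, one_mul]
  rw [h1, Finsupp.prod_mul]
  congr 1
  · rw [Finsupp.prod, Finset.prod_pow_eq_pow_sum]
    congr 1
    rw [← Finset.sum_filter]
    refine Finset.sum_subset (fun i hi => ?_) (fun i hi hin => ?_)
    · rw [Finset.mem_filter] at hi
      exact Finset.mem_erase.mpr ⟨hi.2.2, hi.2.1⟩
    · by_contra hne
      exact hin (Finset.mem_filter.mpr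
        ⟨Finsupp.mem_support_iff.mpr hne, Finset.mem_of_mem_erase hi, Finset.ne_of_mem_erase hi⟩)
  · rw [monomial_eq, C_1, one_mul]

/-- The chart substitution on a monomial: `ψ(c · x^d) = c · x^{d + (Σ_{i ∈ S ∖ j} dᵢ)·e_j}`. -/
theorem coordBlowupSubst_monomial (S : Finset σ) (j : σ) (d : σ →₀ ℕ) (c : K) :
    coordBlowupSubst K (S : Set σ) j (monomial d c) =
      monomial (Finsupp.single j (∑ i ∈ S.erase j, d i) + d) c := by
  rw [monomial_eq, map_mul, coordBlowupSubst_C, map_finsuppProd, prod_coordBlowupSubst_X_pow,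
    X_pow_eq_monomial, ← mul_assoc, C_mul_monomial, monomial_mul, mul_one, mul_one]

/-- **No truncation under permissibility** — the tree's monomial chart law is «total transform
divided by `x_j^q`»: for `j ∈ S` and `q ≤ ord_{(x_S)} F` (every monomial of `F` has `S`-degree
`≥ q`: the coordinate centre `C_S` lies in the `q`-fold locus of `z^q + F`, condition (1) of
Hauser–Perlega §2), `coordBlowupSubst K S j F = x_j^q · CentreBlowup.chartTransform q S j F`. -/
theorem coordBlowupSubst_eq_X_pow_mul_chartTransform {S : Finset σ} {j : σ} (hj : j ∈ S) (q : ℕ)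
    (F : MvPolynomial σ K) (hperm : (q : ℕ∞) ≤ CentreBlowup.ordAlong S F) :
    coordBlowupSubst K (S : Set σ) j F = X j ^ q * CentreBlowup.chartTransform q S j F := by
  have key : ∀ d ∈ F.support, X j ^ q * monomial (CentreBlowup.chartExponent q S j d) (coeff d F) =
      coordBlowupSubst K (S : Set σ) j (monomial d (coeff d F)) := by
    intro d hd
    have hq : q ≤ CentreBlowup.degIn S d := by
      have h : CentreBlowup.ordAlong S F ≤ (CentreBlowup.degIn S d : ℕ∞) := Finset.inf_le hd
      exact_mod_cast hperm.trans h
    have hdeg : d j + ∑ i ∈ S.erase j, d i = CentreBlowup.degIn S d := Finset.add_sum_erase S (⇑d) hj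
    have hexp : Finsupp.single j q + CentreBlowup.chartExponent q S j d =
        Finsupp.single j (∑ i ∈ S.erase j, d i) + d := by
      ext i
      by_cases hij : i = j
      · subst hij
        rw [Finsupp.add_apply, Finsupp.add_apply, Finsupp.single_eq_same, Finsupp.single_eq_same,
          CentreBlowup.chartExponent_apply_self]
        omega
      · rw [Finsupp.add_apply, Finsupp.add_apply, Finsupp.single_apply, Finsupp.single_apply,
          CentreBlowup.chartExponent_apply_of_ne q S hij, if_neg (Ne.symm hij), if_neg (Ne.symm hij)]
    rw [coordBlowupSubst_monomial, X_pow_eq_monomial, monomial_mul, one_mul, hexp]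
  unfold CentreBlowup.chartTransform
  rw [Finset.mul_sum, Finset.sum_congr rfl key, ← map_sum]
  exact congrArg _ F.as_sum

end General

/-! ## §2 The centre `V(z, x_S)` of `𝔸⁵ = Spec K[z, x₁, …, x₄]` and the total transform of `z^q + F` -/

section Hyp

variable {K : Type} [Field K]

/-- `z = X 0` is a coordinate of the centre `V(z, x_S)`, whose set of coordinates is
`Λ_S = insert 0 (Fin.succ '' S)` (the variable convention of `PIDim4.hyp`: `xᵢ = X i.succ`). -/
theorem zero_mem_centreVars (S : Finset (Fin 4)) :
    (0 : Fin (4 + 1)) ∈ (insert 0 (Fin.succ '' (S : Set (Fin 4))) : Set (Fin (4 + 1))) :=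
  Set.mem_insert _ _

/-- `xᵢ` is a coordinate of the centre `V(z, x_S)` iff `i ∈ S`. -/
theorem succ_mem_centreVars_iff (S : Finset (Fin 4)) (i : Fin 4) :
    i.succ ∈ (insert 0 (Fin.succ '' (S : Set (Fin 4))) : Set (Fin (4 + 1))) ↔ i ∈ S := by
  rw [Set.mem_insert_iff, Set.mem_image]
  constructor
  · rintro (h | ⟨i', hi', h⟩)
    · exact absurd h (Fin.succ_ne_zero i)
    · rw [← Fin.succ_inj.mp h]
      exact hi'
  · intro h
    exact Or.inr ⟨i, h, rfl⟩

/-- `xⱼ`, `j ∈ S`, is a coordinate of the centre (the chart index of the `x_j`-chart). -/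
theorem succ_mem_centreVars {S : Finset (Fin 4)} {j : Fin 4} (hj : j ∈ S) :
    j.succ ∈ (insert 0 (Fin.succ '' (S : Set (Fin 4))) : Set (Fin (4 + 1))) :=
  (succ_mem_centreVars_iff S j).mpr hj

/-- On the `x_j`-chart, `z ↦ x_j · z`. -/
theorem coordBlowupSubst_centreVars_X_zero (S : Finset (Fin 4)) (j : Fin 4) :
    coordBlowupSubst K (insert 0 (Fin.succ '' (S : Set (Fin 4)))) j.succ (X 0) = X j.succ * X 0 :=
  coordBlowupSubst_X_of_mem_of_ne K _ j.succ (zero_mem_centreVars S) (Fin.succ_ne_zero j).symm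

/-- On the `x_j`-chart the base variables transform by the chart substitution of `C_S ⊆ 𝔸⁴`:
`ψ_{Λ_S, x_j} (G(x)) = (ψ_{S, j} G)(x)` (the substitution commutes with `xᵢ = X i.succ`). -/
theorem coordBlowupSubst_centreVars_rename (S : Finset (Fin 4)) (j : Fin 4) (G : MvPolynomial (Fin 4) K) :
    coordBlowupSubst K (insert 0 (Fin.succ '' (S : Set (Fin 4)))) j.succ (rename Fin.succ G) =
      rename Fin.succ (coordBlowupSubst K (S : Set (Fin 4)) j G) := by
  have h : (coordBlowupSubst K (insert 0 (Fin.succ '' (S : Set (Fin 4)))) j.succ).comp (rename Fin.succ) =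
      (rename Fin.succ).comp (coordBlowupSubst K (S : Set (Fin 4)) j) := by
    refine MvPolynomial.algHom_ext fun i => ?_
    rw [AlgHom.comp_apply, AlgHom.comp_apply, rename_X, coordBlowupSubst_X, coordBlowupSubst_X]
    by_cases hi : i ∈ S ∧ i ≠ j
    · rw [if_pos (show i ∈ (S : Set (Fin 4)) ∧ i ≠ j from hi),
        if_pos (show i.succ ∈ (insert 0 (Fin.succ '' (S : Set (Fin 4))) : Set (Fin (4 + 1))) ∧
            i.succ ≠ j.succ from ⟨succ_mem_centreVars hi.1, fun h => hi.2 (Fin.succ_inj.mp h)⟩),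
        map_mul, rename_X, rename_X]
    · rw [if_neg (show ¬ (i ∈ (S : Set (Fin 4)) ∧ i ≠ j) from hi), if_neg (fun h => hi
        ⟨(succ_mem_centreVars_iff S i).mp h.1, fun h' => h.2 (congrArg Fin.succ h')⟩), rename_X]
  exact congrArg (fun f : MvPolynomial (Fin 4) K →ₐ[K] MvPolynomial (Fin (4 + 1)) K => f G) h

/-- **The total transform of the hypersurface on the `x_j`-chart**: for `j ∈ S` and
`q ≤ ord_{(x_S)} F` (the centre `V(z, x_S)` is Hironaka-permissible for `z^q + F`),
`ψ (z^q + F) = x_j^q · (z^q + F')` with `F' = CentreBlowup.chartTransform q S j F` — the exceptional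
factor `x_j^q` (multiplicity exactly the marking `q`) times the new equation. -/
theorem coordBlowupSubst_hyp (q : ℕ) {S : Finset (Fin 4)} {j : Fin 4} (hj : j ∈ S)
    (F : MvPolynomial (Fin 4) K) (hperm : (q : ℕ∞) ≤ CentreBlowup.ordAlong S F) :
    coordBlowupSubst K (insert 0 (Fin.succ '' (S : Set (Fin 4)))) j.succ (hyp q F) =
      X j.succ ^ q * hyp q (CentreBlowup.chartTransform q S j F) := by
  rw [hyp, hyp, map_add, map_pow, coordBlowupSubst_centreVars_X_zero, coordBlowupSubst_centreVars_rename,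
    coordBlowupSubst_eq_X_pow_mul_chartTransform hj q F hperm, map_mul, map_pow, rename_X, mul_pow,
    mul_add]

/-- The same under the cell's permissibility predicate `PIDim4.IsPermissibleCentre`. -/
theorem coordBlowupSubst_hyp_of_isPermissibleCentre (q : ℕ) {S : Finset (Fin 4)} {j : Fin 4}
    (hj : j ∈ S) {F : MvPolynomial (Fin 4) K} (hS : IsPermissibleCentre q S F) :
    coordBlowupSubst K (insert 0 (Fin.succ '' (S : Set (Fin 4)))) j.succ (hyp q F) =
      X j.succ ^ q * hyp q (CentreBlowup.chartTransform q S j F) :=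
  coordBlowupSubst_hyp q hj F hS.2

/-! ## §3 Translation to the point `b` of the chart -/

/-- **Translation**: moving the point `(z, x) = (0, b)` of the chart to the origin (`x ↦ x + b`,
`z ↦ z`) carries `z^q + G` to `z^q + translate b G` (the tree's `PointBlowup.translate`). -/
theorem translate_hyp (q : ℕ) (b : Fin 4 → K) (G : MvPolynomial (Fin 4) K) :
    PointBlowup.translate (Fin.cases 0 b) (hyp q G) = hyp q (PointBlowup.translate b G) := by
  unfold PointBlowup.translate hyp
  have hfg : ((fun i : Fin (4 + 1) => (X i + C (Fin.cases (0 : K) b i) : MvPolynomial (Fin (4 + 1)) K)) ∘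
      Fin.succ) = fun i : Fin 4 => rename Fin.succ (X i + C (b i) : MvPolynomial (Fin 4) K) := by
    funext i
    simp only [Function.comp_apply, Fin.cases_succ, map_add, rename_X, rename_C]
  simp only [map_add, map_pow, aeval_X, Fin.cases_zero, C_0, add_zero, aeval_rename, comp_aeval_apply, hfg]

/-- A translation fixing `x_j` (`b_j = 0`) commutes with the exceptional factor `x_j^q`. -/
theorem translate_X_pow_mul (q : ℕ) {b : Fin 4 → K} {j : Fin 4} (hbj : b j = 0)
    (P : MvPolynomial (Fin (4 + 1)) K) :
    PointBlowup.translate (Fin.cases 0 b) (X j.succ ^ q * P) =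
      X j.succ ^ q * PointBlowup.translate (Fin.cases 0 b) P := by
  unfold PointBlowup.translate
  simp only [map_mul, map_pow, aeval_X, Fin.cases_succ, hbj, C_0, add_zero]

/-- Translation to `b` of the new equation: `z^q + CentreBlowup.pointTransform q S j b s`. -/
theorem translate_hyp_chartTransform (q : ℕ) (S : Finset (Fin 4)) (j : Fin 4) (b : Fin 4 → K)
    (s : State K) :
    PointBlowup.translate (Fin.cases 0 b) (hyp q (CentreBlowup.chartTransform q S j s.F)) =
      hyp q (CentreBlowup.pointTransform q S j b s) := by
  rw [translate_hyp]
  rfl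

/-! ## §4 The cleaning coordinate change `z ↦ z + h(x)` -/

/-- `G(x)` viewed in `K[z, x]`: evaluating the variables at `xᵢ = X i.succ` is the renaming `rename Fin.succ`. -/
theorem aeval_X_succ_eq_rename (G : MvPolynomial (Fin 4) K) :
    aeval (fun i : Fin 4 => (X i.succ : MvPolynomial (Fin (4 + 1)) K)) G = rename Fin.succ G := by
  have h : (aeval fun i : Fin 4 => (X i.succ : MvPolynomial (Fin (4 + 1)) K)) = rename Fin.succ :=
    MvPolynomial.algHom_ext fun i => by rw [aeval_X, rename_X]
  rw [h]

/-- **The cleaning coordinate change exists as a `K`-algebra automorphism** of `K[z, x₁, …, x₄]`: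
for every `h(x)` there is `θ` with `θ(z) = z + h(x)` and `θ(xᵢ) = xᵢ` (inverse `z ↦ z − h(x)`) —
Hauser's «apply the coordinate change `x ↦ x + h(y)` which eliminates all `p`-th power monomials»,
for the variable `z` of `z^p + F`. -/
theorem exists_algEquiv_clean (h : MvPolynomial (Fin 4) K) :
    ∃ θ : MvPolynomial (Fin (4 + 1)) K ≃ₐ[K] MvPolynomial (Fin (4 + 1)) K,
      θ (X 0) = X 0 + rename Fin.succ h ∧ ∀ i : Fin 4, θ (X i.succ) = X i.succ := by
  refine ⟨AlgEquiv.ofAlgHom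
    (aeval (Fin.cases (X 0 + rename Fin.succ h) fun i => X i.succ))
    (aeval (Fin.cases (X 0 - rename Fin.succ h) fun i => X i.succ)) ?_ ?_, ?_, fun i => ?_⟩
  · refine MvPolynomial.algHom_ext fun i => ?_
    refine Fin.cases ?_ (fun i => ?_) i
    · simp only [AlgHom.comp_apply, AlgHom.id_apply, aeval_X, Fin.cases_zero, map_sub, aeval_rename,
        Function.comp_def, Fin.cases_succ, aeval_X_succ_eq_rename, add_sub_cancel_right]
    · simp only [AlgHom.comp_apply, AlgHom.id_apply, aeval_X, Fin.cases_succ]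
  · refine MvPolynomial.algHom_ext fun i => ?_
    refine Fin.cases ?_ (fun i => ?_) i
    · simp only [AlgHom.comp_apply, AlgHom.id_apply, aeval_X, Fin.cases_zero, map_add, aeval_rename,
        Function.comp_def, Fin.cases_succ, aeval_X_succ_eq_rename, sub_add_cancel]
    · simp only [AlgHom.comp_apply, AlgHom.id_apply, aeval_X, Fin.cases_succ]
  · change aeval (Fin.cases (X 0 + rename Fin.succ h) fun i => X i.succ) (X 0) = X 0 + rename Fin.succ h
    rw [aeval_X, Fin.cases_zero]
  · change aeval (Fin.cases (X 0 + rename Fin.succ h) fun i => X i.succ) (X i.succ) = X i.succ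
    rw [aeval_X, Fin.cases_succ]

section Clean

variable {θ : MvPolynomial (Fin (4 + 1)) K ≃ₐ[K] MvPolynomial (Fin (4 + 1)) K}
  {h : MvPolynomial (Fin 4) K}

/-- A coordinate change fixing the base variables fixes every polynomial in them. -/
theorem clean_rename (hs : ∀ i : Fin 4, θ (X i.succ) = X i.succ) (G : MvPolynomial (Fin 4) K) :
    θ (rename Fin.succ G) = rename Fin.succ G := by
  have hc : (θ : MvPolynomial (Fin (4 + 1)) K →ₐ[K] MvPolynomial (Fin (4 + 1)) K).comp (rename Fin.succ) =
      rename Fin.succ :=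
    MvPolynomial.algHom_ext fun i => by rw [AlgHom.comp_apply, rename_X, AlgEquiv.coe_toAlgHom, hs]
  exact congrArg (fun f : MvPolynomial (Fin 4) K →ₐ[K] MvPolynomial (Fin (4 + 1)) K => f G) hc

/-- A coordinate change fixing the base variables fixes the exceptional factor `x_j^q`. -/
theorem clean_X_pow_mul (hs : ∀ i : Fin 4, θ (X i.succ) = X i.succ) (j : Fin 4) (q : ℕ)
    (P : MvPolynomial (Fin (4 + 1)) K) : θ (X j.succ ^ q * P) = X j.succ ^ q * θ P := by
  rw [map_mul, map_pow, hs]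

/-- **Cleaning in characteristic `p`**: if `θ(z) = z + h(x)` and `θ(xᵢ) = xᵢ` then
`θ (z^{p^k} + G) = z^{p^k} + (G + h^{p^k})` — the `p^k`-th power of `z + h` is `z^{p^k} + h^{p^k}`
(iterated Frobenius is additive). -/
theorem clean_hyp (p : ℕ) [Fact p.Prime] [CharP K p] (h0 : θ (X 0) = X 0 + rename Fin.succ h)
    (hs : ∀ i : Fin 4, θ (X i.succ) = X i.succ) (k : ℕ) (G : MvPolynomial (Fin 4) K) :
    θ (hyp (p ^ k) G) = hyp (p ^ k) (G + h ^ p ^ k) := by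
  rw [hyp, hyp, map_add, map_pow, h0, clean_rename hs, add_pow_char_pow, map_add, map_pow, add_assoc,
    add_comm (rename Fin.succ G)]

end Clean

/-- **Over a perfect ring of characteristic `p` the tree's cleaning is a coordinate change**: some
`θ` (`z ↦ z + h(x)`, `xᵢ ↦ xᵢ`) gives `θ (z^{p^k} + G) = z^{p^k} + deletePthPowers (p^k) G` (the tree's
`exists_add_pow_eq_deletePthPowers`: `h` = minus the sum of the `p^k`-th roots of the `p^k`-th power
monomials of `G`). -/
theorem exists_clean_hyp_eq_deletePthPowers_pow (p : ℕ) [Fact p.Prime] [CharP K p] [PerfectRing K p]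
    (k : ℕ) (G : MvPolynomial (Fin 4) K) :
    ∃ (θ : MvPolynomial (Fin (4 + 1)) K ≃ₐ[K] MvPolynomial (Fin (4 + 1)) K) (h : MvPolynomial (Fin 4) K),
      θ (X 0) = X 0 + rename Fin.succ h ∧ (∀ i : Fin 4, θ (X i.succ) = X i.succ) ∧
        θ (hyp (p ^ k) G) = hyp (p ^ k) (deletePthPowers (p ^ k) G) := by
  obtain ⟨h, hh⟩ := exists_add_pow_eq_deletePthPowers p k G
  obtain ⟨θ, h0, hs⟩ := exists_algEquiv_clean (K := K) h
  exact ⟨θ, h, h0, hs, by rw [clean_hyp p h0 hs, hh]⟩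

/-! ## §5 The ring-level dictionary: blow-up chart, translation, cleaning = `CentreBlowup.step` -/

/-- **RING-LEVEL DICTIONARY, exponent `p^k`.** For a presented state `s`, a coordinate centre
`S ∋ j`, a point `b` of the exceptional hyperplane of the `x_j`-chart (`b_j = 0`) and
`p^k ≤ ord_{(x_S)} s.F` (permissibility), there is a cleaning coordinate change `θ` (`z ↦ z + h(x)`,
`xᵢ ↦ xᵢ`) such that, after the translation `x ↦ x + b`:
* the total transform `ψ (z^{p^k} + s.F)` of the hypersurface becomes
  `x_j^{p^k} · (z^{p^k} + (CentreBlowup.step (p^k) S j b s).F)` — exceptional factor to the marking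
  times the equation of the tree's next state;
* the new equation `z^{p^k} + F'` (`F' = chartTransform`) becomes `z^{p^k} + (step (p^k) S j b s).F`. -/
theorem exists_clean_translate_hyp_eq_step_pow (p : ℕ) [Fact p.Prime] [CharP K p] [PerfectRing K p]
    [DecidableEq K] (k : ℕ) {S : Finset (Fin 4)} {j : Fin 4} (hj : j ∈ S) {b : Fin 4 → K}
    (hbj : b j = 0) (s : State K) (hperm : ((p ^ k : ℕ) : ℕ∞) ≤ CentreBlowup.ordAlong S s.F) :
    ∃ (θ : MvPolynomial (Fin (4 + 1)) K ≃ₐ[K] MvPolynomial (Fin (4 + 1)) K) (h : MvPolynomial (Fin 4) K),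
      θ (X 0) = X 0 + rename Fin.succ h ∧ (∀ i : Fin 4, θ (X i.succ) = X i.succ) ∧
      θ (PointBlowup.translate (Fin.cases 0 b)
          (coordBlowupSubst K (insert 0 (Fin.succ '' (S : Set (Fin 4)))) j.succ (hyp (p ^ k) s.F))) =
        X j.succ ^ (p ^ k) * hyp (p ^ k) (CentreBlowup.step (p ^ k) S j b s).F ∧
      θ (PointBlowup.translate (Fin.cases 0 b) (hyp (p ^ k) (CentreBlowup.chartTransform (p ^ k) S j s.F))) =
        hyp (p ^ k) (CentreBlowup.step (p ^ k) S j b s).F := by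
  obtain ⟨θ, h, h0, hs, hh⟩ :=
    exists_clean_hyp_eq_deletePthPowers_pow p k (CentreBlowup.pointTransform (p ^ k) S j b s)
  have h2 : θ (PointBlowup.translate (Fin.cases 0 b)
      (hyp (p ^ k) (CentreBlowup.chartTransform (p ^ k) S j s.F))) =
      hyp (p ^ k) (CentreBlowup.step (p ^ k) S j b s).F := by
    rw [translate_hyp_chartTransform, hh]
    rfl
  refine ⟨θ, h, h0, hs, ?_, h2⟩
  rw [coordBlowupSubst_hyp (p ^ k) hj s.F hperm, translate_X_pow_mul (p ^ k) hbj, clean_X_pow_mul hs, h2]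

/-- **RING-LEVEL DICTIONARY, class of record (`e = 1`, exponent `p`).** For `j ∈ S`, `b_j = 0` and
`V(z, x_S)` Hironaka-permissible for `z^p + s.F` (`p ≤ ord_{(x_S)} s.F`, `PIDim4.IsPermissibleCentre`),
some cleaning coordinate change `θ` (`z ↦ z + h(x)`, `xᵢ ↦ xᵢ`) gives, after the translation
`x ↦ x + b`, `θ (ψ (z^p + s.F)) = x_j^p · (z^p + (CentreBlowup.step p S j b s).F)` and
`θ (z^p + F') = z^p + (CentreBlowup.step p S j b s).F`: the `x_j`-chart of the blow-up of `𝔸⁵` along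
`V(z, x_S)`, re-centred at `b` and cleaned, carries the controlled (= strict, `m = p`) transform of
`V(z^p + s.F)` to `V(z^p + (step p S j b s).F)`. -/
theorem exists_clean_translate_hyp_eq_step (p : ℕ) [Fact p.Prime] [CharP K p] [PerfectRing K p]
    [DecidableEq K] {S : Finset (Fin 4)} {j : Fin 4} (hj : j ∈ S) {b : Fin 4 → K} (hbj : b j = 0)
    (s : State K) (hperm : (p : ℕ∞) ≤ CentreBlowup.ordAlong S s.F) :
    ∃ (θ : MvPolynomial (Fin (4 + 1)) K ≃ₐ[K] MvPolynomial (Fin (4 + 1)) K) (h : MvPolynomial (Fin 4) K),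
      θ (X 0) = X 0 + rename Fin.succ h ∧ (∀ i : Fin 4, θ (X i.succ) = X i.succ) ∧
      θ (PointBlowup.translate (Fin.cases 0 b)
          (coordBlowupSubst K (insert 0 (Fin.succ '' (S : Set (Fin 4)))) j.succ (hyp p s.F))) =
        X j.succ ^ p * hyp p (CentreBlowup.step p S j b s).F ∧
      θ (PointBlowup.translate (Fin.cases 0 b) (hyp p (CentreBlowup.chartTransform p S j s.F))) =
        hyp p (CentreBlowup.step p S j b s).F := by
  simpa only [pow_one] using
    exists_clean_translate_hyp_eq_step_pow p 1 hj hbj s (by simpa only [pow_one] using hperm)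

/-- The same for a step of the cell's relation `PIDim4.Edge` along a permissible centre: every edge
`s ⟶ s'` of the blow-up of `V(z, x_S)` (`PIDim4.IsPermissibleCentre p S s.F`) comes with a chart `j`,
a point `b` and a cleaning change `θ` carrying `z^p + F'` to `z^p + s'.F`. -/
theorem exists_clean_translate_hyp_eq_of_edge (p : ℕ) [Fact p.Prime] [CharP K p] [PerfectRing K p]
    [DecidableEq K] {S : Finset (Fin 4)} {s s' : State K} (hS : IsPermissibleCentre p S s.F)
    (he : Edge p S s s') :
    ∃ (j : Fin 4) (b : Fin 4 → K) (θ : MvPolynomial (Fin (4 + 1)) K ≃ₐ[K] MvPolynomial (Fin (4 + 1)) K)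
      (h : MvPolynomial (Fin 4) K),
      j ∈ S ∧ b j = 0 ∧ θ (X 0) = X 0 + rename Fin.succ h ∧ (∀ i : Fin 4, θ (X i.succ) = X i.succ) ∧
      θ (PointBlowup.translate (Fin.cases 0 b)
          (coordBlowupSubst K (insert 0 (Fin.succ '' (S : Set (Fin 4)))) j.succ (hyp p s.F))) =
        X j.succ ^ p * hyp p s'.F ∧
      θ (PointBlowup.translate (Fin.cases 0 b) (hyp p (CentreBlowup.chartTransform p S j s.F))) =
        hyp p s'.F := by
  obtain ⟨j, b, hj, hbj, -, -, rfl⟩ := he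
  obtain ⟨θ, h, h0, hs, h1, h2⟩ := exists_clean_translate_hyp_eq_step p hj hbj s hS.2
  exact ⟨j, b, θ, h, hj, hbj, h0, hs, h1, h2⟩

end Hyp

end ChartDictionary

end Summit.ResolutionOfSingularities.ResolutionOfSingularities.Theorems.PIDim4

end
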